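import Summits.CriticalPhenomena.SAWScalingLimit.Theses.SAWReversalUpgrade
import Literature.Probability.RandomPlanarGeometry.DrivingCapacitySampling
import HarnessLib

/-!
# `stub_mesoscopicKeyEstimate` from its sampled form (line `lsw-engine`, crux `ForwardDriving`, stmt-CriticalPhenomena-18003)

Reshaping of the open stub S1 of the line: the Lawler–Schramm–Werner raw driving data demanded by
`stub_mesoscopicKeyEstimate` (any adapted capacities / driving values / histories with the two key estimates)
are supplied by the CANONICAL ones — the driving function of the attached walk sampled at the LSW stopping
capacities `capStop` and frozen from a truncation index on (`SkorokhodEmbedding.sampledData`,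
`Literature/Probability/RandomPlanarGeometry/DrivingCapacitySampling.lean`) — as soon as those are valid.
`keyEstimate_of_sampled` is that implication (sorry-free); the remaining open statement
(`stub_sampledKeyEstimate` in `Cruxes/ForwardDriving/Lines/lsw_engine.lean`) speaks only of histories, a
truncation index, the two conditional-moment bounds of the sampled increments, and `P(τ < N) → 0`.
[cite: LawlerSchrammWerner2004, Theorem 3.7]
-/

noncomputable section

namespace Summit.CriticalPhenomena.SAWScalingLimit.Cruxes.ForwardDriving.LswEngine

open scoped BigOperators Topology Classical MeasureTheory ProbabilityTheory NNReal ENNReal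
open scoped Literature.Probability.RandomPlanarGeometry.PathBorel
open Filter Set Function TopologicalSpace MeasureTheory

/-- **S1 from its sampled form** (the reshaped open stub `stub_sampledKeyEstimate` ⇒ the registered
`stub_mesoscopicKeyEstimate`, instance by instance and WITHOUT the attachment hypothesis): if the critical SAW
law carries refining histories `H`, a truncation index `τ` and a mesoscopic scale `dm δ → 0` for which the raw
driving data obtained by SAMPLING the driving function of the attached walk at the Lawler–Schramm–Werner
stopping capacities (`SkorokhodEmbedding.sampledData`, frozen from `τ` on, `κ = 8/3`) are valid up to a horizon
`N δ` in the window `(8/3+2)T+1 ≤ N δ'² ≤ (8/3+2)T+2`, with `P(τ < N) → 0`, then the raw driving data demanded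
by `stub_mesoscopicKeyEstimate` exist: take these; law, driving function, `κ`, constants are definitional, and
the failure event of the lower bound is contained in `{τ < N}` (`sampledData_lowerFailSet_subset`).
[cite: LawlerSchrammWerner2004, Theorem 3.7] -/
theorem keyEstimate_of_sampled :
    ∀ (D : Literature.Probability.RandomPlanarGeometry.DobrushinDomain) (a b : ℝ → Literature.Probability.LatticeModels.Site 2) (φ : Literature.Probability.RandomPlanarGeometry.ConformalEquiv UpperHalfPlane.upperHalfPlaneSet D.carrier) (att : ((δ : ℝ) → Literature.Probability.RandomPlanarGeometry.SAW.DomainSAW (D).carrier δ (a δ) (b δ) → Literature.Probability.RandomPlanarGeometry.Curve ℂ)) (T : NNReal), (∃ (Λ : Type) (_ : DecidableEq Λ) (_ : MeasurableSpace Λ) (_ : Countable Λ) (_ : MeasurableSingletonClass Λ) (C₁ C₂ : ℝ) (dm : ℝ → ℝ) (H : (δ : ℝ) → ℕ → Literature.Probability.RandomPlanarGeometry.SAW.DomainSAW D.carrier δ (a δ) (b δ) → Λ) (τ : (δ : ℝ) → Literature.Probability.RandomPlanarGeometry.SAW.DomainSAW D.carrier δ (a δ) (b δ) → ℕ) (N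 : ℝ → ℕ), 0 ≤ C₁ ∧ 0 ≤ C₂ ∧ Filter.Tendsto dm (nhdsWithin 0 (Set.Ioi 0)) (nhds 0) ∧ Filter.Tendsto (fun δ => Literature.Probability.RandomPlanarGeometry.SAW.law D.carrier δ (a δ) (b δ) {γ | τ δ γ < N δ}) (nhdsWithin 0 (Set.Ioi 0)) (nhds 0) ∧ ∀ᶠ δ in nhdsWithin 0 (Set.Ioi 0), ∃ (_ : Fintype (Literature.Probability.RandomPlanarGeometry.SAW.DomainSAW D.carrier δ (a δ) (b δ))), (Literature.Probability.RandomPlanarGeometry.SkorokhodEmbedding.sampledData (Literature.Probability.RandomPlanarGeometry.SAW.law D.carrier δ (a δ) (b δ)) (H δ) (fun γ => (⟨Literature.Probability.RandomPlanarGeometry.drivingFunction φ (Literature.Probability.RandomPlanarGeometry.CurveClass.mk (att δ γ)), Literature.Probability.RandomPlanarGeometry.continuous_drivingFunction φ (Literature.Probability.RandomPlanarGeometry.CurveClass.mk (att δ γ))⟩ : C(NNReal, ℝ))) (τ δ) (dm δ) (8/3) C₁ C₂).IsValid (N δ) ∧ (8/3 + 2) * (T : ℝ) + 1 ≤ (N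 δ : ℝ) * (dm δ)^2 ∧ (N δ : ℝ) * (dm δ)^2 ≤ (8/3 + 2) * (T : ℝ) + 2) → (∃ (Λ : Type) (_ : DecidableEq Λ) (_ : MeasurableSpace Λ) (_ : Countable Λ) (_ : MeasurableSingletonClass Λ) (C₁ C₂ : ℝ) (RD : (δ : ℝ) → Literature.Probability.RandomPlanarGeometry.SkorokhodEmbedding.RawDrivingData (Literature.Probability.RandomPlanarGeometry.SAW.DomainSAW D.carrier δ (a δ) (b δ)) Λ) (N : ℝ → ℕ), 0 ≤ C₁ ∧ 0 ≤ C₂ ∧ (∀ δ, (RD δ).P = Literature.Probability.RandomPlanarGeometry.SAW.law D.carrier δ (a δ) (b δ) ∧ (RD δ).κ = 8/3 ∧ (RD δ).C₁ ≤ C₁ ∧ (RD δ).C₂ ≤ C₂ ∧ (RD δ).drv = fun γ => (⟨Literature.Probability.RandomPlanarGeometry.drivingFunction φ (Literature.Probability.RandomPlanarGeometry.CurveClass.mk (att δ γ)), Literature.Probability.RandomPlanarGeometry.continuous_drivingFunction φ (Literature.Probability.RandomPlanarGeometry.CurveClass.mk (att δ γ))⟩ : C(NNReal, ℝ))) ∧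 Filter.Tendsto (fun δ => (RD δ).δ) (nhdsWithin 0 (Set.Ioi 0)) (nhds 0) ∧ Filter.Tendsto (fun δ => (RD δ).P {ω | ∃ k < N δ, ((RD δ).dval (k+1) ω - (RD δ).dval k ω)^2 + (((RD δ).tcap (k+1) ω : ℝ) - (RD δ).tcap k ω) < (RD δ).δ^2}) (nhdsWithin 0 (Set.Ioi 0)) (nhds 0) ∧ ∀ᶠ δ in nhdsWithin 0 (Set.Ioi 0), ∃ (_ : Fintype (Literature.Probability.RandomPlanarGeometry.SAW.DomainSAW D.carrier δ (a δ) (b δ))), (RD δ).IsValid (N δ) ∧ (8/3 + 2) * (T : ℝ) + 1 ≤ (N δ : ℝ) * (RD δ).δ^2 ∧ (N δ : ℝ) * (RD δ).δ^2 ≤ (8/3 + 2) * (T : ℝ) + 2) := by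
  intro D a b φ att T h
  obtain ⟨Λ, i1, i2, i3, i4, C₁, C₂, dm, H, τ, N, hC₁, hC₂, hdm, hτN, hval⟩ := h
  refine ⟨Λ, i1, i2, i3, i4, C₁, C₂, fun δ =>
    Literature.Probability.RandomPlanarGeometry.SkorokhodEmbedding.sampledData
      (Literature.Probability.RandomPlanarGeometry.SAW.law D.carrier δ (a δ) (b δ)) (H δ)
      (fun γ => (⟨Literature.Probability.RandomPlanarGeometry.drivingFunction φ
          (Literature.Probability.RandomPlanarGeometry.CurveClass.mk (att δ γ)),
        Literature.Probability.RandomPlanarGeometry.continuous_drivingFunction φ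
          (Literature.Probability.RandomPlanarGeometry.CurveClass.mk (att δ γ))⟩ : C(NNReal, ℝ)))
      (τ δ) (dm δ) (8/3) C₁ C₂, N, hC₁, hC₂, fun δ => ⟨rfl, rfl, le_rfl, le_rfl, rfl⟩, hdm, ?_, ?_⟩
  · -- the lower bound fails only after truncation, and `P(τ < N) → 0`
    have hpos : ∀ᶠ δ in nhdsWithin (0:ℝ) (Set.Ioi 0), 0 ≤ dm δ := by
      filter_upwards [hval] with δ hδ
      obtain ⟨_, hV, -, -⟩ := hδ
      exact hV.δ_pos.le
    refine tendsto_of_tendsto_of_tendsto_of_le_of_le' tendsto_const_nhds hτN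
      (Filter.Eventually.of_forall fun δ => bot_le) ?_
    filter_upwards [hpos] with δ hδ
    exact measure_mono
      (Literature.Probability.RandomPlanarGeometry.SkorokhodEmbedding.sampledData_lowerFailSet_subset hδ (N δ))
  · filter_upwards [hval] with δ hδ
    obtain ⟨inst, hV, hlo, hhi⟩ := hδ
    exact ⟨inst, hV, hlo, hhi⟩

end Summit.CriticalPhenomena.SAWScalingLimit.Cruxes.ForwardDriving.LswEngine

end
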